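import Summits.FinalStateConjecture.FinalStateConjecture.Theorems.PhaseMixingCaptureNearExtremalKappaCaptureUnitTemperatureFaceFrame
import Summits.FinalStateConjecture.FinalStateConjecture.Theorems.PhaseMixingCaptureNearExtremalKappaCaptureUnitTemperatureFaceClosedForm

/-!
# S1 `stub_unitTemperatureFace`: the resolved near-extremal Kerr family at its event horizon

Line `unit-temperature-front-face` for the crux `NearExtremalKappaCapture` (route `PhaseMixingCapture`,
stmt-FinalStateConjecture-10606), registered stub S1. Blow the degenerating family `Kerr(M, a)`,
`|a| → M`, up at its event horizon in the co-rotating, thermally rescaled Kerr-star frame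
`ê = (κ⁻¹K, (r₊ − r₋)∂_r, ∂_θ, ∂_φ*)` (`K = T + ω₊Φ = Kerr.hawkingVector`), with `σ = √(1 − a²/M²)`,
`x̂ = (r − r₊)/(r₊ − r₋)`: the ten Kerr–Schild components `G_{αβ}(σ, x̂, θ) = g_{M,a}(ê_α, ê_β)` are
`M²` times explicit rational functions of `(σ, x̂, cos θ, √(1 − σ²))` with denominator
`D = (1 + σ + 2σx̂)² + (1 − σ²)cos²θ = Σ/M² ≥ 1` (parts 1–2: the `κ⁻²`, `κ⁻¹` blow-up factors of
`G₀₀ = κ⁻²g(K,K)`, `G₀₃ = κ⁻¹g(K,Φ)` cancel algebraically because `g(K,K)`, `g(K,Φ)` vanish to order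
`σ²`, `σ` at `σ = 0`), so they extend JOINTLY SMOOTHLY to the extremal face `σ = 0` (part 3), where
they are near-NHEK at unit temperature in ingoing co-rotating form
`ds² = M²(1+c²)[−4x̂(1+x̂)dt̂² + 4dt̂dx̂ + dθ²] + (4M²(1−c²)/(1+c²))(dφ̂ + 2x̂dt̂)²`, and on every face
the horizon `x̂ = 0` has unit surface gravity (`G₀₀ = 0`, `G₀₁ = 2Σ₊`, `∂_x̂G₀₀ = −2G₀₁`). This file
only assembles: the family `G` is the explicit table of closed forms, and the four clauses are the
support lemmas `smoothαβ`, `compαβ`, `horizon00/01/Deriv`, `faceαβ`. No named fact is used.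
-/

noncomputable section

-- the doubled `FinalStateConjecture.FinalStateConjecture` path component trips dupNamespace
set_option linter.dupNamespace false

namespace Summit.FinalStateConjecture.FinalStateConjecture.Theorems.NearExtremalKappaCapture.UnitTemperatureFrontFace

open Literature.Geometry.Lorentzian
open Set Filter
open scoped Topology Manifold ENNReal ContDiff

/-- **S1 · `stub_unitTemperatureFace`** (registered stub of the line `unit-temperature-front-face`,
crux `NearExtremalKappaCapture`): for `M > 0` and a face depth `X > 0` there is a family of component
matrices `G σ x̂ θ : Fin 4 → Fin 4 → ℝ`, jointly `C^∞` on `[0, ½] × [−½, X] × ℝ` up to and including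
the extremal face `σ = 0`, such that (i) for `0 < σ ≤ ½`, `a = M√(1 − σ²)`,
`G σ x̂ θ α β = g_{M,a}(ê_α, ê_β)` at `pt = (0, Y_a(r, θ, φ))`, `r = r₊ + x̂(r₊ − r₋)`, in the blown-up
co-rotating Kerr-star frame `ê = (κ⁻¹K, (r₊ − r₋)(0, n̂), (0, r θ̂ + a cos θ φ̂), Φ)`; (ii) on every face
`σ ∈ [0, ½]` the horizon `x̂ = 0` has `G₀₀ = 0`, `G₀₁ = 2Σ₊`, `∂_x̂G₀₀ = −2G₀₁`; (iii) the front face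
`σ = 0` is near-NHEK at unit temperature in ingoing co-rotating coordinates (the ten explicit values).
Proof: `G` is the explicit table of closed forms of parts 2–3 (`comp`, `smooth`, `face`, `horizon`
lemmas of the support files); everything is explicit real algebra over the tree's Kerr–Schild
definitions. -/
theorem stub_unitTemperatureFace :
    (∀ M : ℝ, 0 < M → ∀ X : ℝ, 0 < X →
      ∃ G : ℝ → ℝ → ℝ → Fin 4 → Fin 4 → ℝ,
        ContDiffOn ℝ ∞ (fun q : ℝ × ℝ × ℝ ↦ G q.1 q.2.1 q.2.2)
            (Icc (0 : ℝ) (1 / 2) ×ˢ Icc (-(1 / 2) : ℝ) X ×ˢ (univ : Set ℝ)) ∧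
        (∀ σ ∈ Ioc (0 : ℝ) (1 / 2), ∀ x ∈ Icc (-(1 / 2) : ℝ) X, ∀ θ φ : ℝ, ∀ α β : Fin 4,
          ∀ (a r : ℝ) (pt : E4) (e : Fin 4 → E4), a = M * √(1 - σ ^ 2) →
            r = Kerr.rPlus M a + x * (Kerr.rPlus M a - Kerr.rMinus M a) →
            pt = E4.ofTimeSpace 0 (Kerr.kerrStar a r θ φ) →
            e = ![(Kerr.surfaceGravity M a)⁻¹ • Kerr.hawkingVector M a pt,
                  (Kerr.rPlus M a - Kerr.rMinus M a) • E4.ofTimeSpace 0 (sphRadial θ φ),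
                  E4.ofTimeSpace 0 (r • sphPolar θ φ + (a * Real.cos θ) • sphAzimuth φ),
                  Kerr.axialVector pt] →
            G σ x θ α β = Kerr.bilin M a pt (e α) (e β)) ∧
        (∀ σ ∈ Icc (0 : ℝ) (1 / 2), ∀ θ : ℝ,
          G σ 0 θ 0 0 = 0 ∧
          G σ 0 θ 0 1 = 2 * (Kerr.rPlus M (M * √(1 - σ ^ 2)) ^ 2 + (M * √(1 - σ ^ 2)) ^ 2 * Real.cos θ ^ 2) ∧
          deriv (fun x : ℝ ↦ G σ x θ 0 0) 0 = -2 * G σ 0 θ 0 1) ∧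
        (∀ x ∈ Icc (-(1 / 2) : ℝ) X, ∀ θ : ℝ,
          G 0 x θ 0 0 = -4 * M ^ 2 * (1 + Real.cos θ ^ 2) * x * (1 + x) +
              16 * M ^ 2 * (1 - Real.cos θ ^ 2) * x ^ 2 / (1 + Real.cos θ ^ 2) ∧
          G 0 x θ 0 1 = 2 * M ^ 2 * (1 + Real.cos θ ^ 2) ∧ G 0 x θ 1 1 = 0 ∧
          G 0 x θ 2 2 = M ^ 2 * (1 + Real.cos θ ^ 2) ∧
          G 0 x θ 3 3 = 4 * M ^ 2 * (1 - Real.cos θ ^ 2) / (1 + Real.cos θ ^ 2) ∧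
          G 0 x θ 0 3 = 8 * M ^ 2 * (1 - Real.cos θ ^ 2) * x / (1 + Real.cos θ ^ 2) ∧
          G 0 x θ 0 2 = 0 ∧ G 0 x θ 1 2 = 0 ∧ G 0 x θ 1 3 = 0 ∧ G 0 x θ 2 3 = 0)) := by
  intro M hM X hX
  refine ⟨fun σ x θ ↦
    ![![M ^ (2 : ℕ) * (-4 * x * (1 + σ) * (Real.cos θ ^ (4 : ℕ) * σ ^ (3 : ℕ) * x + Real.cos θ
          ^ (4 : ℕ) * σ ^ (3 : ℕ) - Real.cos θ ^ (4 : ℕ) * σ ^ (2 : ℕ) * x - Real.cos θ ^ (4 :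
          ℕ) * σ ^ (2 : ℕ) - Real.cos θ ^ (4 : ℕ) * σ * x - Real.cos θ ^ (4 : ℕ) * σ + Real.cos
          θ ^ (4 : ℕ) * x + Real.cos θ ^ (4 : ℕ) - 4 * Real.cos θ ^ (2 : ℕ) * σ ^ (3 : ℕ) * x ^
          (3 : ℕ) - 8 * Real.cos θ ^ (2 : ℕ) * σ ^ (3 : ℕ) * x ^ (2 : ℕ) - 6 * Real.cos θ ^ (2 :
          ℕ) * σ ^ (3 : ℕ) * x - 2 * Real.cos θ ^ (2 : ℕ) * σ ^ (3 : ℕ) + 4 * Real.cos θ ^ (2 :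
          ℕ) * σ ^ (2 : ℕ) * x ^ (3 : ℕ) - 6 * Real.cos θ ^ (2 : ℕ) * σ ^ (2 : ℕ) * x - 2 *
          Real.cos θ ^ (2 : ℕ) * σ ^ (2 : ℕ) + 8 * Real.cos θ ^ (2 : ℕ) * σ * x ^ (2 : ℕ) + 6 *
          Real.cos θ ^ (2 : ℕ) * σ * x + 2 * Real.cos θ ^ (2 : ℕ) * σ + 6 * Real.cos θ ^ (2 : ℕ)
          * x + 2 * Real.cos θ ^ (2 : ℕ) + 4 * σ ^ (3 : ℕ) * x ^ (3 : ℕ) + 8 * σ ^ (3 : ℕ) * x ^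
          (2 : ℕ) + 5 * σ ^ (3 : ℕ) * x + σ ^ (3 : ℕ) - 4 * σ ^ (2 : ℕ) * x ^ (3 : ℕ) + 7 * σ ^
          (2 : ℕ) * x + 3 * σ ^ (2 : ℕ) - 8 * σ * x ^ (2 : ℕ) - σ * x + 3 * σ - 3 * x + 1) / ((1
          + σ + 2 * σ * x) ^ (2 : ℕ) + (1 - σ ^ (2 : ℕ)) * Real.cos θ ^ (2 : ℕ))),
        M ^ (2 : ℕ) * (2 * (4 * (1 + σ) * (1 + σ + 2 * σ * x) - (1 - σ ^ (2 : ℕ)) * (1 -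
          Real.cos θ ^ (2 : ℕ)) * (((1 + σ + 2 * σ * x) ^ (2 : ℕ) + (1 - σ ^ (2 : ℕ)) * Real.cos
          θ ^ (2 : ℕ)) + 2 * (1 + σ + 2 * σ * x))) / ((1 + σ + 2 * σ * x) ^ (2 : ℕ) + (1 - σ ^
          (2 : ℕ)) * Real.cos θ ^ (2 : ℕ))),
        0,
        M ^ (2 : ℕ) * (4 * x * √(1 - σ ^ (2 : ℕ)) * (1 - Real.cos θ ^ (2 : ℕ)) * (-(Real.cos θ
          ^ (2 : ℕ) * σ ^ (3 : ℕ) * x) - Real.cos θ ^ (2 : ℕ) * σ ^ (3 : ℕ) + Real.cos θ ^ (2 :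
          ℕ) * σ * x + Real.cos θ ^ (2 : ℕ) * σ + 4 * σ ^ (3 : ℕ) * x ^ (3 : ℕ) + 8 * σ ^ (3 :
          ℕ) * x ^ (2 : ℕ) + 5 * σ ^ (3 : ℕ) * x + σ ^ (3 : ℕ) + 8 * σ ^ (2 : ℕ) * x ^ (2 : ℕ) +
          12 * σ ^ (2 : ℕ) * x + 4 * σ ^ (2 : ℕ) + 7 * σ * x + 5 * σ + 2) / ((1 + σ + 2 * σ * x)
          ^ (2 : ℕ) + (1 - σ ^ (2 : ℕ)) * Real.cos θ ^ (2 : ℕ)))],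
      ![M ^ (2 : ℕ) * (2 * (4 * (1 + σ) * (1 + σ + 2 * σ * x) - (1 - σ ^ (2 : ℕ)) * (1 -
          Real.cos θ ^ (2 : ℕ)) * (((1 + σ + 2 * σ * x) ^ (2 : ℕ) + (1 - σ ^ (2 : ℕ)) * Real.cos
          θ ^ (2 : ℕ)) + 2 * (1 + σ + 2 * σ * x))) / ((1 + σ + 2 * σ * x) ^ (2 : ℕ) + (1 - σ ^
          (2 : ℕ)) * Real.cos θ ^ (2 : ℕ))),
        M ^ (2 : ℕ) * (4 * σ ^ (2 : ℕ) * (((1 + σ + 2 * σ * x) ^ (2 : ℕ) + (1 - σ ^ (2 : ℕ)) *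
          Real.cos θ ^ (2 : ℕ)) + 2 * (1 + σ + 2 * σ * x)) / ((1 + σ + 2 * σ * x) ^ (2 : ℕ) + (1
          - σ ^ (2 : ℕ)) * Real.cos θ ^ (2 : ℕ))),
        0,
        M ^ (2 : ℕ) * (-2 * σ * √(1 - σ ^ (2 : ℕ)) * (1 - Real.cos θ ^ (2 : ℕ)) * (((1 + σ + 2
          * σ * x) ^ (2 : ℕ) + (1 - σ ^ (2 : ℕ)) * Real.cos θ ^ (2 : ℕ)) + 2 * (1 + σ + 2 * σ *
          x)) / ((1 + σ + 2 * σ * x) ^ (2 : ℕ) + (1 - σ ^ (2 : ℕ)) * Real.cos θ ^ (2 : ℕ)))],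
      ![0, 0, M ^ (2 : ℕ) * ((1 + σ + 2 * σ * x) ^ (2 : ℕ) + (1 - σ ^ (2 : ℕ)) * Real.cos θ ^ (2 :
          ℕ)), 0],
      ![M ^ (2 : ℕ) * (4 * x * √(1 - σ ^ (2 : ℕ)) * (1 - Real.cos θ ^ (2 : ℕ)) * (-(Real.cos θ
          ^ (2 : ℕ) * σ ^ (3 : ℕ) * x) - Real.cos θ ^ (2 : ℕ) * σ ^ (3 : ℕ) + Real.cos θ ^ (2 :
          ℕ) * σ * x + Real.cos θ ^ (2 : ℕ) * σ + 4 * σ ^ (3 : ℕ) * x ^ (3 : ℕ) + 8 * σ ^ (3 :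
          ℕ) * x ^ (2 : ℕ) + 5 * σ ^ (3 : ℕ) * x + σ ^ (3 : ℕ) + 8 * σ ^ (2 : ℕ) * x ^ (2 : ℕ) +
          12 * σ ^ (2 : ℕ) * x + 4 * σ ^ (2 : ℕ) + 7 * σ * x + 5 * σ + 2) / ((1 + σ + 2 * σ * x)
          ^ (2 : ℕ) + (1 - σ ^ (2 : ℕ)) * Real.cos θ ^ (2 : ℕ))),
        M ^ (2 : ℕ) * (-2 * σ * √(1 - σ ^ (2 : ℕ)) * (1 - Real.cos θ ^ (2 : ℕ)) * (((1 + σ + 2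
          * σ * x) ^ (2 : ℕ) + (1 - σ ^ (2 : ℕ)) * Real.cos θ ^ (2 : ℕ)) + 2 * (1 + σ + 2 * σ *
          x)) / ((1 + σ + 2 * σ * x) ^ (2 : ℕ) + (1 - σ ^ (2 : ℕ)) * Real.cos θ ^ (2 : ℕ))),
        0,
        M ^ (2 : ℕ) * ((1 - Real.cos θ ^ (2 : ℕ)) * (((1 + σ + 2 * σ * x) ^ (2 : ℕ) + (1 - σ ^
          (2 : ℕ))) * ((1 + σ + 2 * σ * x) ^ (2 : ℕ) + (1 - σ ^ (2 : ℕ)) * Real.cos θ ^ (2 : ℕ))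
          + 2 * (1 + σ + 2 * σ * x) * (1 - σ ^ (2 : ℕ)) * (1 - Real.cos θ ^ (2 : ℕ))) / ((1 + σ
          + 2 * σ * x) ^ (2 : ℕ) + (1 - σ ^ (2 : ℕ)) * Real.cos θ ^ (2 : ℕ)))]], ?_, ?_, ?_, ?_⟩
  · -- joint smoothness on the box, entry by entry
    refine contDiffOn_pi' fun α ↦ contDiffOn_pi' fun β ↦ ?_
    fin_cases α <;> fin_cases β <;>
      simp only [Fin.zero_eta, Fin.mk_one, Fin.reduceFinMk, Matrix.cons_val_zero, Matrix.cons_val_one, Matrix.cons_val]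
    · exact smooth00 M X
    · exact smooth01 M X
    · exact contDiffOn_const
    · exact smooth03 M X
    · exact smooth01 M X
    · exact smooth11 M X
    · exact contDiffOn_const
    · exact smooth13 M X
    · exact contDiffOn_const
    · exact contDiffOn_const
    · exact smooth22 M X
    · exact contDiffOn_const
    · exact smooth03 M X
    · exact smooth13 M X
    · exact contDiffOn_const
    · exact smooth33 M X
  · -- (i) the table IS the blown-up frame of Kerr(M, M√(1 − σ²)) for σ > 0
    rintro σ hσ x hx θ φ α β a r pt e ha hr rfl rfl
    fin_cases α <;> fin_cases β <;>
      simp only [Fin.zero_eta, Fin.mk_one, Fin.reduceFinMk, Matrix.cons_val_zero, Matrix.cons_val_one, Matrix.cons_val]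
    · exact (comp00 hM hσ hx.1 ha hr θ φ).symm
    · exact (comp01 hM hσ hx.1 ha hr θ φ).symm
    · exact (comp02 hM hσ hx.1 ha hr θ φ).symm
    · exact (comp03 hM hσ hx.1 ha hr θ φ).symm
    · rw [Kerr.bilin_symm]; exact (comp01 hM hσ hx.1 ha hr θ φ).symm
    · exact (comp11 hM hσ hx.1 ha hr θ φ).symm
    · exact (comp12 hM hσ hx.1 ha hr θ φ).symm
    · exact (comp13 hM hσ hx.1 ha hr θ φ).symm
    · rw [Kerr.bilin_symm]; exact (comp02 hM hσ hx.1 ha hr θ φ).symm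
    · rw [Kerr.bilin_symm]; exact (comp12 hM hσ hx.1 ha hr θ φ).symm
    · exact (comp22 hM hσ hx.1 ha hr θ φ).symm
    · exact (comp23 hM hσ hx.1 ha hr θ φ).symm
    · rw [Kerr.bilin_symm]; exact (comp03 hM hσ hx.1 ha hr θ φ).symm
    · rw [Kerr.bilin_symm]; exact (comp13 hM hσ hx.1 ha hr θ φ).symm
    · rw [Kerr.bilin_symm]; exact (comp23 hM hσ hx.1 ha hr θ φ).symm
    · exact (comp33 hM hσ hx.1 ha hr θ φ).symm
  · -- (ii) unit surface gravity of the horizon x̂ = 0 on every face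
    intro σ hσ θ
    exact ⟨horizon00 M σ (Real.cos θ), horizon01 hM hσ (Real.cos θ), horizonDeriv hM hσ (Real.cos θ)⟩
  · -- (iii) the front face σ = 0 is near-NHEK at unit temperature
    intro x hx θ
    exact ⟨face00 M x (Real.cos θ), face01 M x (Real.cos θ), face11 M x (Real.cos θ),
      face22 M x (Real.cos θ), face33 M x (Real.cos θ), face03 M x (Real.cos θ), rfl, rfl,
      face13 M x (Real.cos θ), rfl⟩

end Summit.FinalStateConjecture.FinalStateConjecture.Theorems.NearExtremalKappaCapture.UnitTemperatureFrontFace
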